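import Summits.Schanuel.Schanuel.Theorems.ZilberEacCriticalFibresExistence
import Summits.Schanuel.Schanuel.Theorems.ZilberEacCriticalFibresSupply
import Summits.Schanuel.Schanuel.Theorems.ZilberEacCriticalFibresGeneric
import Summits.Schanuel.Schanuel.Theorems.ZilberEacCriticalEqualFibreDensity
import HarnessLib

/-!
# The critical size with ARBITRARY fibre polynomials: Zariski density
# `{x₂ = r₀x₀ + (1/e - r₀)x₁ + c, y₀ = x₀ + y₂F₀(y₂), y₁ = x₁ + y₂F₁(y₂)}`, `deg F₁ ≤ deg F₀ = e - 1`

Zilber's Exponential-Algebraic Closedness, case ladder (host summit Schanuel, cell `pub-schanuel`,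
seat 2, gen 14).  THE FAMILY (`F₀, F₁ ∈ ℂ[u]`, `F₀ ≠ 0`, `deg F₁ ≤ deg F₀`, `e = deg F₀ + 1`,
`r₀ ∈ ℝ ∖ ℚ`, `c ∈ ℂ`):

  `W = {x₂ = r₀x₀ + (1/e - r₀)x₁ + c,  y₀ = x₀ + y₂F₀(y₂),  y₁ = x₁ + y₂F₁(y₂)} ⊆ ℂ³ × ℂ³`

— the critical size `λ(1 + deg F₀) = 1` with an ARBITRARY second fibre polynomial of degree at most
`deg F₀` (equal: gen 13; smaller degree: the second fibre is slow; same degree with a different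
leading coefficient: a genuinely COUPLED limit system).  This was the open clause O56 (a) of the
cell's census ("UNEQUAL fibres at critical size … needs a non-degenerate solution of a coupled 2×2
exponential system (Rouché/degree theory, not in the tree)").  No degree theory is needed: the
coupled limit system `e^{ρⱼ} = P + aⱼe^{K + αρ₀ + (1-α)ρ₁}` REDUCES TO ONE COMPLEX VARIABLE
`t = αρ₀ + (1-α)ρ₁` — solutions are the points where the local holomorphic function
`Φ(t) = α log E₀(t) + (1-α) log E₁(t) - t` takes a value in the dense subset `-2πi(αℤ + ℤ)` of `iℝ`
(`ZilberEacCriticalFibresZero`: a zero of `Re Φ` by the intermediate value theorem on the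
path-connected domain; `…Local`: non-degeneracy via the open mapping theorem and a holomorphic local
inverse; `…Supply`: exact hits of the dense lattice values by Dirichlet labels; `…Generic`: the
resulting pairs `(ρ₁ - ρ₀, e^{ρ₀})` are Zariski-generic because `e^{ρ₀}` accumulates at infinitely
many values while `‖ρ₁ - ρ₀‖ → ∞`).  Existence along the diagonal rays: the implicit function
theorem at the rescaled entire system (`exists_solutions_criticalFibres`); elimination: THEOREM N₂
(`unprojectedDense_of_bddLinLin`) in the coordinates `(x₀, x₁, y₀)`.

**THEOREM (`unprojectedDense_polyFibredGraph_critical_fibres`).**  `I(W ∩ Γ_exp) = I(W)`.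
`polyFibredGraph_critical_fibres_member_dense`: all seven hypotheses of `ECCell 3 2`, not linearly
split, `W ∩ Γ_exp ≠ ∅`, dense.  Examples: **`sqrtTwoHalfSqOne_member_dense`**
`{x₂ = √2x₀ + (1/2 - √2)x₁, y₀ = x₀ + y₂², y₁ = x₁ + y₂}` (one critical and one slow fibre) and
**`sqrtTwoHalfSqTwoSq_member_dense`** `{x₂ = √2x₀ + (1/2 - √2)x₁, y₀ = x₀ + y₂², y₁ = x₁ + 2y₂²}`
(two critical fibres with different leading coefficients) ∈ EC(3,2), DENSE.

HONEST FRAMING: explicit families inside an OPEN cell (the case `deg F₁ > deg F₀` is the same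
theorem with the fibres renamed; fibres FASTER than critical, targets of degree ≥ 2 and real
hyperplanes in higher dimension stay open); `EC(3,2)` OPEN; NOT Schanuel's conjecture; EAC ⇏ SC.
-/

noncomputable section

open Complex MvPolynomial Filter Topology
open Literature.NumberTheory.Transcendental Literature.ModelTheory.Zilber
  Literature.ModelTheory.ExponentialFields

set_option linter.dupNamespace false

namespace Summit.Schanuel.Schanuel.Theorems

section FibresDensity

/-- **THEOREM (Zariski density at critical size, arbitrary fibre polynomials).**  See the module
docstring. (new) [cite: MantovaMasser2023, §1 p.5 (the open case dim π(V) = 2 in ℂ³×ℂˣ³)] -/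
theorem unprojectedDense_polyFibredGraph_critical_fibres (F : Fin 2 → Polynomial ℂ)
    (hF0 : F 0 ≠ 0) (hdeg : (F 1).natDegree ≤ (F 0).natDegree) (r₀ : ℝ) (hr : Irrational r₀)
    (c : ℂ) :
    UnprojectedDense (polyFibredGraph
      (hyperplanePoly ![r₀, 1 / (((F 0).natDegree + 1 : ℕ) : ℝ) - r₀] c) (fun j => X j)
      (fun j => (F j).toMvPolynomial 0)) := by
  classical
  have hπ := Real.pi_pos
  have h2πI : (2 * Real.pi * I : ℂ) ≠ 0 := Complex.two_pi_I_ne_zero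
  set e : ℕ := (F 0).natDegree + 1 with hedef
  have he : 1 ≤ e := by omega
  have he0 : e ≠ 0 := by omega
  have heC : (e : ℂ) ≠ 0 := by exact_mod_cast he0
  have heR : (e : ℝ) ≠ 0 := by exact_mod_cast he0
  have hdegj : ∀ j : Fin 2, (F j).natDegree < e := by
    intro j
    fin_cases j
    · simp only [Fin.zero_eta]; omega
    · simp only [Fin.mk_one]; omega
  -- leading data
  set a₀ : ℂ := (F 0).coeff (e - 1) with ha₀
  set a₁ : ℂ := (F 1).coeff (e - 1) with ha₁
  have ha₀0 : a₀ ≠ 0 := by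
    rw [ha₀, hedef, Nat.add_sub_cancel, Polynomial.coeff_natDegree]
    exact Polynomial.leadingCoeff_ne_zero.2 hF0
  set α : ℝ := (e : ℝ) * r₀ with hα
  have hαirr : Irrational α := by
    rw [hα]; simpa using hr.natCast_mul he0
  set K : ℂ := (e : ℂ) * c with hK
  set P : ℂ := 2 * Real.pi * I * (e : ℂ) * ((1 : ℤ) : ℂ) with hP
  have hP0 : P ≠ 0 := by
    rw [hP]; push_cast; rw [mul_one]; exact mul_ne_zero h2πI heC
  -- conversion between the `(α, K)` and the `(e, r₀, c)` forms of the exponent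
  have hconv : ∀ ρ : ℂ × ℂ, K + (α : ℂ) * ρ.1 + (1 - (α : ℂ)) * ρ.2 =
      (e : ℂ) * (c + (r₀ : ℂ) * ρ.1 + ((1 / (e : ℝ) - r₀ : ℝ) : ℂ) * ρ.2) := by
    intro ρ
    rw [hK, hα]
    push_cast
    field_simp
  -- the supply of limit pairs and their genericity
  obtain ⟨𝒯, h𝒯, hsup⟩ := exists_limitPairs_supply a₀ a₁ ha₀0 hαirr K hP0
  set PS : Set (ℂ × ℂ) := {vt | ∃ ρ : ℂ × ℂ,
    exp ρ.1 = P + a₀ * exp (K + (α : ℂ) * ρ.1 + (1 - (α : ℂ)) * ρ.2) ∧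
    exp ρ.2 = P + a₁ * exp (K + (α : ℂ) * ρ.1 + (1 - (α : ℂ)) * ρ.2) ∧
    (1 - (α : ℂ)) * exp ρ.1 + α * exp ρ.2 ≠ 0 ∧ vt = (ρ.2 - ρ.1, exp ρ.1)} with hPS
  have hgen : ∀ Q : MvPolynomial (Fin 2) ℂ, Q ≠ 0 → ∃ vt ∈ PS, eval ![vt.1, vt.2] Q ≠ 0 := by
    intro Q hQ
    refine pairs_generic_of_limitSupply h𝒯 (PS := PS) (fun T hT => ?_) Q hQ
    obtain ⟨ρ, hev, hnorm, hlim⟩ := hsup T hT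
    refine ⟨fun k => ((ρ k).2 - (ρ k).1, exp (ρ k).1), ?_, hnorm, hlim⟩
    filter_upwards [hev] with k hk
    exact ⟨ρ k, hk.1, hk.2.1, hk.2.2, rfl⟩
  set r : Fin 2 → ℝ := ![r₀, 1 / (e : ℝ) - r₀] with hrdef
  refine unprojectedDense_of_bddLinLin (isIrreducibleClosed_polyFibredGraph _ _ _)
    (by rw [zariskiDim_polyFibredGraph]) ![Sum.inl 0, Sum.inl 1, Sum.inr 0]
    (Wst := 2 * Real.pi * I * (e : ℂ)) (mul_ne_zero h2πI heC) hgen ?_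
  rintro _ ⟨ρs, hl0, hl1, hnd, rfl⟩
  -- base solution in the form of the existence theorem
  have h0 : exp ρs.1 = 2 * Real.pi * I * (e : ℂ) * ((1 : ℤ) : ℂ) +
      (fun j i => (F j).coeff i) 0 (e - 1) * exp ((e : ℂ) * (c + (r₀ : ℂ) * ρs.1 +
        ((1 / (e : ℝ) - r₀ : ℝ) : ℂ) * ρs.2)) := by
    rw [hl0, hconv]
  have h1 : exp ρs.2 = 2 * Real.pi * I * (e : ℂ) * ((1 : ℤ) : ℂ) +
      (fun j i => (F j).coeff i) 1 (e - 1) * exp ((e : ℂ) * (c + (r₀ : ℂ) * ρs.1 +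
        ((1 / (e : ℝ) - r₀ : ℝ) : ℂ) * ρs.2)) := by
    rw [hl1, hconv]
  have hdet : ((1 / (e : ℝ) - r₀ : ℝ) : ℂ) * exp ρs.1 + (r₀ : ℂ) * exp ρs.2 ≠ 0 := by
    intro h
    apply hnd
    have : (1 - (α : ℂ)) * exp ρs.1 + (α : ℂ) * exp ρs.2 =
        (e : ℂ) * (((1 / (e : ℝ) - r₀ : ℝ) : ℂ) * exp ρs.1 + (r₀ : ℂ) * exp ρs.2) := by
      rw [hα]; push_cast; field_simp
    rw [this, h, mul_zero]
  obtain ⟨x, ρ, hρ, hx0, hx1, hsol⟩ :=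
    exists_solutions_criticalFibres e he (fun j i => (F j).coeff i) r₀ c (p := 1) one_ne_zero
      h0 h1 hdet
  set P3 : ℕ → Fin 3 ⊕ Fin 3 → ℂ := fun m =>
    pgParam (hyperplanePoly r c) (fun j => X j) (fun j => (F j).toMvPolynomial 0)
      (x m) (exp (∑ i, (r i : ℂ) * x m i + c)) with hP3
  have hρ1 : Tendsto (fun m => (ρ m).1) atTop (𝓝 ρs.1) := (continuous_fst.tendsto _).comp hρ
  have hρ2 : Tendsto (fun m => (ρ m).2) atTop (𝓝 ρs.2) := (continuous_snd.tendsto _).comp hρ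
  have hs0 : Tendsto (fun m : ℕ => (((1 / (m : ℝ) : ℝ)) : ℂ)) atTop (𝓝 0) := by
    have h := (continuous_ofReal.tendsto (0 : ℝ)).comp tendsto_one_div_atTop_nhds_zero_nat
    rw [ofReal_zero] at h
    exact h
  have hl0' : Tendsto (fun m : ℕ => (((Real.log m / (m : ℝ) : ℝ)) : ℂ)) atTop (𝓝 0) := by
    have h := (continuous_ofReal.tendsto (0 : ℝ)).comp
      (tendsto_log_pow_div_natCast_comp (d := fun m => m) tendsto_id 1)
    rw [ofReal_zero] at h
    refine h.congr fun m => ?_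
    simp only [Function.comp_apply, pow_one]
  -- the solution property in the shape of `pgParam_hyperplane_mem_expGraph`
  have hsolW : ∀ᶠ m in atTop, ∀ j : Fin 2, exp (x m j) = eval (x m) (X j) +
      exp (∑ i, (r i : ℂ) * x m i + c) * (F j).eval (exp (∑ i, (r i : ℂ) * x m i + c)) := by
    filter_upwards [hsol] with m hm j
    rw [eval_X, Polynomial.eval_eq_sum_range' (hdegj j), hm j]
  refine ⟨P3, fun m => (m : ℝ), ?_, tendsto_natCast_atTop_atTop, ?_, ?_, ?_⟩
  · filter_upwards [hsolW] with m hm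
    exact ⟨pgParam_mem _ _ _ _ _, pgParam_hyperplane_mem_expGraph r c (fun j => X j) F hm⟩
  · -- `x₁ - x₀ → ρ₁* - ρ₀*`
    have hlim : Tendsto (fun m => (ρ m).2 - (ρ m).1) atTop (𝓝 (ρs.2 - ρs.1)) := hρ2.sub hρ1
    refine hlim.congr fun m => ?_
    have e0 : (Sum.inl 0 : Fin 3 ⊕ Fin 3) = Sum.inl (Fin.castSucc (0 : Fin 2)) := rfl
    have e1 : (Sum.inl 1 : Fin 3 ⊕ Fin 3) = Sum.inl (Fin.castSucc (1 : Fin 2)) := rfl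
    simp only [hP3, Matrix.cons_val_one, Matrix.cons_val_zero, e0, e1, pgParam_inl_castSucc,
      hx0 m, hx1 m]
    ring
  · -- `x₀ / m → 2πi e`
    have hlim : Tendsto (fun m : ℕ => 2 * Real.pi * I * (e : ℂ) +
        (((Real.log m / (m : ℝ) : ℝ)) : ℂ) + (ρ m).1 * (((1 / (m : ℝ) : ℝ)) : ℂ)) atTop
        (𝓝 (2 * Real.pi * I * (e : ℂ) + 0 + ρs.1 * 0)) :=
      (tendsto_const_nhds.add hl0').add (hρ1.mul hs0)
    simp only [add_zero, mul_zero] at hlim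
    refine hlim.congr' ?_
    filter_upwards [eventually_ge_atTop 1] with m hm
    have hmC : (m : ℂ) ≠ 0 := by exact_mod_cast (show m ≠ 0 by omega)
    have e0 : (Sum.inl 0 : Fin 3 ⊕ Fin 3) = Sum.inl (Fin.castSucc (0 : Fin 2)) := rfl
    simp only [hP3, Matrix.cons_val_zero, e0, pgParam_inl_castSucc, hx0 m]
    push_cast
    field_simp
  · -- `y₀ / m = e^{x₀}/m = e^{ρ₀(m)} → e^{ρ₀*}`
    have hlim : Tendsto (fun m => exp (ρ m).1) atTop (𝓝 (exp ρs.1)) :=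
      (Complex.continuous_exp.tendsto _).comp hρ1
    refine hlim.congr' ?_
    filter_upwards [hsolW, eventually_ge_atTop 1] with m hm hm1
    have hmpos : (0 : ℝ) < (m : ℝ) := by exact_mod_cast hm1
    have hmC : (m : ℂ) ≠ 0 := by exact_mod_cast (show m ≠ 0 by omega)
    have hexpL : exp ((Real.log m : ℝ) : ℂ) = (m : ℂ) := by
      rw [← Complex.ofReal_exp, Real.exp_log hmpos]
      push_cast
      rfl
    have hexpP : exp (2 * Real.pi * I * (e : ℂ) * ((1 : ℤ) : ℂ) * (m : ℂ)) = 1 := by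
      have := Complex.exp_int_mul_two_pi_mul_I ((e : ℤ) * m)
      rw [← this]; congr 1; push_cast; ring
    have e0 : (Sum.inr 0 : Fin 3 ⊕ Fin 3) = Sum.inr (Fin.castSucc (0 : Fin 2)) := rfl
    have hcoord : P3 m (Sum.inr 0) = exp (x m 0) := by
      simp only [hP3, e0, pgParam_inr, pMulParam_castSucc]
      rw [hm 0, MvPolynomial.eval_toMvPolynomial, Fin.cons_zero]
    rw [show (![Sum.inl 0, Sum.inl 1, Sum.inr 0] : Fin 3 → Fin 3 ⊕ Fin 3) 2 = Sum.inr 0 from rfl,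
      hcoord, hx0 m, Complex.exp_add, Complex.exp_add, hexpP, one_mul, hexpL]
    push_cast
    field_simp

/-- **Certified members at critical size with arbitrary fibre polynomials, dense.**  `F₀ ≠ 0`,
`deg F₁ ≤ deg F₀`, `r₀` irrational, `c ∈ ℂ`: all seven hypotheses of `ECCell 3 2`, not linearly
split, `W ∩ Γ_exp ≠ ∅`, `I(W ∩ Γ_exp) = I(W)`. (new)
[cite: MantovaMasser2023, §1 p.5 (the open case dim π(V) = 2 in ℂ³×ℂˣ³)] -/
theorem polyFibredGraph_critical_fibres_member_dense (F : Fin 2 → Polynomial ℂ) (hF0 : F 0 ≠ 0)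
    (hdeg : (F 1).natDegree ≤ (F 0).natDegree) (r₀ : ℝ) (hr : Irrational r₀) (c : ℂ) :
    (IsIrreducibleClosed ℂ (polyFibredGraph
        (hyperplanePoly ![r₀, 1 / (((F 0).natDegree + 1 : ℕ) : ℝ) - r₀] c) (fun j => X j)
        (fun j => (F j).toMvPolynomial 0)) ∧
      (polyFibredGraph (hyperplanePoly ![r₀, 1 / (((F 0).natDegree + 1 : ℕ) : ℝ) - r₀] c)
          (fun j => X j) (fun j => (F j).toMvPolynomial 0) ∩ torusLocus ℂ 3).Nonempty ∧
      IsRotund ℂ 3 (polyFibredGraph (hyperplanePoly ![r₀, 1 / (((F 0).natDegree + 1 : ℕ) : ℝ) - r₀] c)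
          (fun j => X j) (fun j => (F j).toMvPolynomial 0) ∩ torusLocus ℂ 3) ∧
      IsAddFree ℂ 3 (polyFibredGraph (hyperplanePoly ![r₀, 1 / (((F 0).natDegree + 1 : ℕ) : ℝ) - r₀] c)
          (fun j => X j) (fun j => (F j).toMvPolynomial 0) ∩ torusLocus ℂ 3) ∧
      IsMulFree ℂ 3 (polyFibredGraph (hyperplanePoly ![r₀, 1 / (((F 0).natDegree + 1 : ℕ) : ℝ) - r₀] c)
          (fun j => X j) (fun j => (F j).toMvPolynomial 0) ∩ torusLocus ℂ 3) ∧
      zariskiDim ℂ (polyFibredGraph (hyperplanePoly ![r₀, 1 / (((F 0).natDegree + 1 : ℕ) : ℝ) - r₀] c)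
          (fun j => X j) (fun j => (F j).toMvPolynomial 0)) = (3 : ℕ) ∧
      addProjDim ℂ 3 (polyFibredGraph (hyperplanePoly ![r₀, 1 / (((F 0).natDegree + 1 : ℕ) : ℝ) - r₀] c)
          (fun j => X j) (fun j => (F j).toMvPolynomial 0)) = (2 : ℕ)) ∧
    ¬ IsLinearSplit ℂ 3 (polyFibredGraph
        (hyperplanePoly ![r₀, 1 / (((F 0).natDegree + 1 : ℕ) : ℝ) - r₀] c) (fun j => X j)
        (fun j => (F j).toMvPolynomial 0)) ∧
    (polyFibredGraph (hyperplanePoly ![r₀, 1 / (((F 0).natDegree + 1 : ℕ) : ℝ) - r₀] c)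
        (fun j => X j) (fun j => (F j).toMvPolynomial 0) ∩ expGraph ℂ 3).Nonempty ∧
    UnprojectedDense (polyFibredGraph
        (hyperplanePoly ![r₀, 1 / (((F 0).natDegree + 1 : ℕ) : ℝ) - r₀] c) (fun j => X j)
        (fun j => (F j).toMvPolynomial 0)) := by
  have hA : Function.Injective (aeval (fun j : Fin 2 => (X j : MvPolynomial (Fin 2) ℂ)) :
      MvPolynomial (Fin 2) ℂ →ₐ[ℂ] MvPolynomial (Fin 2) ℂ) := by
    rw [aeval_X_left]; exact fun _ _ h => h
  have hirr : ∃ i : Fin 2, Irrational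
      ((![r₀, 1 / (((F 0).natDegree + 1 : ℕ) : ℝ) - r₀] : Fin 2 → ℝ) i) := ⟨0, by simpa using hr⟩
  have hcell := ecCell_hypotheses_polyFibredGraph_hyperplane
    ![r₀, 1 / (((F 0).natDegree + 1 : ℕ) : ℝ) - r₀] c (fun j => X j)
    (fun j => (F j).toMvPolynomial 0) hA hirr
  have hdense := unprojectedDense_polyFibredGraph_critical_fibres F hF0 hdeg r₀ hr c
  refine ⟨hcell, not_isLinearSplit_polyFibredGraph _ (fun j => X j) _ (by norm_num) hA, ?_,
    hdense⟩
  obtain ⟨w, hw, -⟩ := hcell.2.1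
  exact inter_expGraph_nonempty_of_vanishingIdeal_eq ⟨w, hw⟩ hdense

/-- **A critical fibre next to a slow one is dense**:
`W = {x₂ = √2x₀ + (1/2 - √2)x₁, y₀ = x₀ + y₂², y₁ = x₁ + y₂}` (`F₀ = u`, `F₁ = 1`, `e = 2`): all seven
hypotheses of `ECCell 3 2`, not linearly split, `W ∩ Γ_exp ≠ ∅`, `I(W ∩ Γ_exp) = I(W)`. (new)
[cite: MantovaMasser2023, §1 p.5 (the open case dim π(V) = 2 in ℂ³×ℂˣ³)] -/
theorem sqrtTwoHalfSqOne_member_dense :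
    let F : Fin 2 → Polynomial ℂ := ![Polynomial.X, 1]
    let W := polyFibredGraph (hyperplanePoly ![Real.sqrt 2,
        1 / (((F 0).natDegree + 1 : ℕ) : ℝ) - Real.sqrt 2] 0) (fun j => X j)
      (fun j => (F j).toMvPolynomial 0)
    (IsIrreducibleClosed ℂ W ∧ (W ∩ torusLocus ℂ 3).Nonempty ∧ IsRotund ℂ 3 (W ∩ torusLocus ℂ 3) ∧
        IsAddFree ℂ 3 (W ∩ torusLocus ℂ 3) ∧ IsMulFree ℂ 3 (W ∩ torusLocus ℂ 3) ∧
        zariskiDim ℂ W = (3 : ℕ) ∧ addProjDim ℂ 3 W = (2 : ℕ)) ∧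
      ¬ IsLinearSplit ℂ 3 W ∧ (W ∩ expGraph ℂ 3).Nonempty ∧ UnprojectedDense W :=
  polyFibredGraph_critical_fibres_member_dense ![Polynomial.X, 1]
    (by simp) (by simp) (Real.sqrt 2) irrational_sqrt_two 0

/-- **Two critical fibres with different leading coefficients are dense**:
`W = {x₂ = √2x₀ + (1/2 - √2)x₁, y₀ = x₀ + y₂², y₁ = x₁ + 2y₂²}` (`F₀ = u`, `F₁ = 2u`, `e = 2`; the
limit system is genuinely coupled): all seven hypotheses of `ECCell 3 2`, not linearly split,
`W ∩ Γ_exp ≠ ∅`, `I(W ∩ Γ_exp) = I(W)`. (new)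
[cite: MantovaMasser2023, §1 p.5 (the open case dim π(V) = 2 in ℂ³×ℂˣ³)] -/
theorem sqrtTwoHalfSqTwoSq_member_dense :
    let F : Fin 2 → Polynomial ℂ := ![Polynomial.X, Polynomial.C 2 * Polynomial.X]
    let W := polyFibredGraph (hyperplanePoly ![Real.sqrt 2,
        1 / (((F 0).natDegree + 1 : ℕ) : ℝ) - Real.sqrt 2] 0) (fun j => X j)
      (fun j => (F j).toMvPolynomial 0)
    (IsIrreducibleClosed ℂ W ∧ (W ∩ torusLocus ℂ 3).Nonempty ∧ IsRotund ℂ 3 (W ∩ torusLocus ℂ 3) ∧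
        IsAddFree ℂ 3 (W ∩ torusLocus ℂ 3) ∧ IsMulFree ℂ 3 (W ∩ torusLocus ℂ 3) ∧
        zariskiDim ℂ W = (3 : ℕ) ∧ addProjDim ℂ 3 W = (2 : ℕ)) ∧
      ¬ IsLinearSplit ℂ 3 W ∧ (W ∩ expGraph ℂ 3).Nonempty ∧ UnprojectedDense W := by
  refine polyFibredGraph_critical_fibres_member_dense ![Polynomial.X, Polynomial.C 2 * Polynomial.X]
    (by simp) ?_ (Real.sqrt 2) irrational_sqrt_two 0
  simp only [Matrix.cons_val_one, Matrix.cons_val_zero, Polynomial.natDegree_X]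
  exact (Polynomial.natDegree_C_mul_le _ _).trans (by simp)

end FibresDensity

end Summit.Schanuel.Schanuel.Theorems

end
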